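import Summits.BirchSwinnertonDyer.BirchSwinnertonDyer.Theorems.ManinLocalTwoThreeCThreeResidualOfFacts
import Summits.BirchSwinnertonDyer.BirchSwinnertonDyer.Theorems.ManinLocalTwoThreeDescentTwo
import HarnessLib

/-!
# E-es-36o at `(2,2,n)` and E-es-22 BY NAME, modulo the named Literature/Chebotarev inputs (descent discharged)

Summit `BirchSwinnertonDyer`, route `ManinLocalTwoThree` (cell bsd-f2-manin), crux C2 `ManinOddAtFour` (stmt-BirchSwinnertonDyer-22967),
line `kato_shift_two` v6, registered stub 3 `stub_cThreeImageResidual` (the 3 950 `C₃`-image classes).  With the lead's index-2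
descent `shiftInvariantDescentTwo_two_of_two_le` (E-es-37, `Theorems/ManinLocalTwoThreeDescentTwo.lean`) the MEMO-es §25 chain is
complete in the tree:

* `relativeIharaShiftVanishingParOdd_two_two_of_facts (h43) (n) : RelativeIharaShiftVanishingParOdd 2 2 n` — -ty's leaf E-es-36o
  at `(2,2,n)` from the Serre-amalgam fact alone;
* `multiShiftClassGenerationTwo_of_facts` — E-es-22 `MultiShiftClassGenerationTwo`;
  (the stub-3 signature itself modulo the four named inputs is p2's `cThreeImageResidual_of_facts`,
  `Theorems/ManinLocalTwoThreeCThreeResidualOfFourFacts.lean`, composing the same pieces).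

Authorship of the chain (cell bsd-f2-manin): plan MEMO-es §25 (es g11–g13); LEMMA G / E-es-38 / E-es-39 / E-es-42 / E-es-37 (p1 lead);
E-es-29a / E-es-30 / N4 / σ2 / t = 2 vertex (p2); E-es-34 / END / E-es-25 assembly / consumer / vertex assembly / odd-`t` vertex /
compositions (p3); leaves and facts typed by -ty; audits -ref1 §R47.

No new definitions; nothing about BSD or Manin's conjecture is proved here: the result is CONDITIONAL on the four named inputs.
-/

set_option autoImplicit false
set_option linter.dupNamespace false

noncomputable section

open scoped MatrixGroups

open CongruenceSubgroup Literature.NumberTheory.EllipticCurves.ModularForms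
  Literature.NumberTheory.EllipticCurves.ModularForms.HidaCohomology
  Summit.BirchSwinnertonDyer.Rank1Residual.ManinAdditive
  Literature.NumberTheory.EllipticCurves Literature.GroupTheory.SpecificGroups

namespace Summit.BirchSwinnertonDyer.BirchSwinnertonDyer.Theorems.ManinLocalTwoThree

/-- **E-es-36o at `(2,2,n)` from the Serre-amalgam fact alone** (descent = the lead's `shiftInvariantDescentTwo_two_of_two_le`).
[cite: Shimura1971, §8.3 (8.3.2)] -/
theorem relativeIharaShiftVanishingParOdd_two_two_of_facts
    (h43 : gamma0Away_character_extension_of_shiftInvariant) (n : ℕ) : RelativeIharaShiftVanishingParOdd 2 2 n :=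
  relativeIharaShiftVanishingParOdd_two_two_of_descent₂ h43 shiftInvariantDescentTwo_two_of_two_le n

/-- **E-es-22 `MultiShiftClassGenerationTwo` modulo the four named inputs.** [cite: Shimura1971, §8.3 (8.3.2)] -/
theorem multiShiftClassGenerationTwo_of_facts
    (h27 : sl2ZModOddPrime_existsUnique_extension_of_stable_character)
    (h43 : gamma0Away_character_extension_of_shiftInvariant)
    (hNT2 : NotTrivialEisensteinOfIrreducibleAtTwo) (hNT : NotTrivialEisensteinOfIrreducibleTwo) :
    MultiShiftClassGenerationTwo :=
  multiShiftClassGenerationTwo_of_descent₂_and_facts shiftInvariantDescentTwo_two_of_two_le h27 h43 hNT2 hNT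

end Summit.BirchSwinnertonDyer.BirchSwinnertonDyer.Theorems.ManinLocalTwoThree

end
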